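import Literature.NumberTheory.Automorphic.SymplecticSimilitudeSatakeSpTransfer
import HarnessLib

/-!
# Weyl-group invariance of the Satake transform of `GSp_{2n}` in every rank: `𝒮_q(T)` is invariant under
# `W(GSp_{2n}) = (ℤ/2)^n ⋊ S_n` acting on `X_*(S) = ℤⁿ × ℤ` (Andrianov–Zhuravlev Ch. 3 Thm. 3.30; Cartier §IV Thm. 4.1 (b);
# Satake 1963 §7)

Topic `NumberTheory/Automorphic`; namespace `Literature.NumberTheory.Automorphic.SymplecticCartan` (lane `lit-hodgefound`,
Track 2 foundations; seat `lit-hodgefound-p11`, generation 51, row g51-#2).  DEFINITIONS with bodies (`similitudeSignedPermEquiv`,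
`similitudeWeylGroup`) + theorems; no named fact, no instance, no notation.  Sequel of `SymplecticSimilitudeSatakeSpTransfer`
(g51-#1: the multiplier-zero part of `ℋ(GSp)` and its transfer to the `Sp_{2n}` theorem `coeff_symplecticSatakeTransform_signedPerm`).

## The mathematics

`G = GSp(J, K)` over a discretely valued field `K` (compact `𝒪`, residue cardinality `q`), `K₀ = GSp(J, 𝒪)`, exponents
`(a, c) : G → X_*(S) = ℤⁿ × ℤ` (`c = ord r`), weight `q^{⟨ρ, a⟩}`.  The Weyl group of `GSp_{2n}` is Andrianov–Zhuravlev's `W_n`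
([AndrianovZhuravlev1995] (3.51)): generated by the permutations of `x_1, …, x_n` and the involutions
`τ_i : x_0 ↦ x_0 x_i, x_i ↦ x_i⁻¹`; on exponents `x_0^c x^μ` the element `(ε, π) ∈ (ℤ/2)^n ⋊ S_n` acts by
**`(μ, c) ↦ ((μ_{π i} if ε_i = 1, c - μ_{π i} if ε_i = -1)_i, c)`** (`similitudeSignedPermEquiv`; `ε = -1, π = 1` is the
longest element `w₀ : (μ, c) ↦ (c·1 - μ, c)` of the tree's `coeff_similitudeSatakeTransform_w0`; on `c = 0` it is the signed
permutation `(ε_i μ_{π i})_i` of `W(C_n)`).  THEOREM (A–Z Thm. 3.30 «`Ω(L^n_p) ⊆ ℚ[x_0^{±1}, …, x_n^{±1}]_W`»; [CartierCorvallis1979]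
Thm. 4.1 (b); [Satake1963] §7): for every commutative ring `R` in which the residue cardinality is a unit `q`, every
`T ∈ ℋ_R(G, K₀)`, every `(ε, π)` and every `λ ∈ ℤⁿ × ℤ`,

  **`𝒮_q(T)_{w_{ε,π} λ} = 𝒮_q(T)_λ`**,   i.e. `𝒮_q(ℋ_R) ⊆ R[ℤⁿ × ℤ]^{W(GSp_{2n})}`.

PROOF (a shorter road than A–Z's generator computation (3.58)–(3.70), available because the tree already holds the `Sp_{2n}`
theorem; by linearity it suffices to treat `T = T_g`).  Let `K₀ g K₀ = K₀ t(m, a) K₀` (Cartan); then `T_{g⁻¹} = T_{ϖ^{-m}·1} T_g`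
(`doubleCosetOperator_inv_similitude`), so in the commutative algebra `ℋ_R`

  `𝒮(T_g)² · 𝒮(T_{ϖ^{-m}·1}) = 𝒮(T_g T_{g⁻¹})`,   `𝒮(T_{ϖ^{-m}·1}) = q^{⟨ρ,-m·1⟩} x^{(-m·1, -2m)}` (a `W`-fixed unit monomial).

The product `T_g T_{g⁻¹}` lives on multiplier-zero cosets, where `W(GSp_{2n})` acts through `W(C_n)` and `𝒮` is the push-forward of
the `Sp_{2n}` transform (g51-#1): so `𝒮(T_g T_{g⁻¹})` is `W`-invariant, hence so is `F² = 𝒮(T_g)²`.  Over `R = ℚ` (`q = #𝓀`) the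
group algebra `ℚ[ℤⁿ × ℤ]` is a domain, so `(wF)² = F²` forces `wF = ±F`, and `wF = -F` is impossible unless `F = 0` because every
coefficient `𝒮_q(T_g)_λ = N(λ) q^{⟨ρ,λ₁⟩}` (`N(λ) = #{γ ∈ K₀gK₀/K₀ : (a,c)(γ) = λ}`) is `≥ 0`.  This proves the COUNTING IDENTITY
**`N(wλ) · q^{E⁺} = N(λ) · q^{(-E)⁺}`**, `E = ⟨ρ,(wλ)₁⟩ - ⟨ρ,λ₁⟩`, an identity of natural numbers, which gives the theorem over
every `R` with `(q : R) = #𝓀` a unit (as the tree does for `w₀` in `SymplecticSimilitudeBorelModulusIndex`).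

## What is formalised

* §1 **`similitudeSignedPermEquiv ε π : (ℤⁿ × ℤ) ≃ₗ[ℤ] (ℤⁿ × ℤ)`**, `_apply`, `_apply_zero` (`= ` signed permutation on `c = 0`),
  `_apply_const` (the central exponents `(k·1, 2k)` are fixed), `snd_…`; **`similitudeWeylGroup n`**,
  `similitudeSignedPermEquiv_mem_similitudeWeylGroup`, **`mem_weylInvariants_similitudeWeylGroup_iff`**,
  `coeff_similitudeSignedPermEquiv_eq_of_zero` (multiplier-zero + `W(C_n)`-invariant ⇒ `W(GSp)`-invariant).
* §2 `eq_zero_of_domCongr_eq_neg` (non-negative coefficients; with Mathlib's `mul_self_eq_mul_self_iff` in the domain `ℚ[ℤⁿ × ℤ]`).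
* §3 `similitudeSatakeTransform_doubleCosetOperator_central` (`𝒮(T_{ϖ^k·1})`), `natCard_residueField_pos`,
  **`coeff_similitudeSatakeTransform_doubleCosetOperator_signedPerm_rat`** (THE SQUARE TRICK over `ℚ`).
* §4 **`card_filter_similitudeIwasawaExp_signedPerm_mul_pow_eq`** (the counting identity in `ℕ`),
  **`coeff_similitudeSatakeTransform_doubleCosetOperator_signedPerm`** (every `R`), **`coeff_similitudeSatakeTransform_signedPerm`**
  (THE THEOREM, every `T`), `_signedPerm'` (spelled out), `coeff_similitudeSatakeTransform_comp_perm` (`S_n`),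
  `coeff_similitudeSatakeTransform_tau` (`τ_j`), **`similitudeSatakeTransform_mem_weylInvariants`**,
  `range_similitudeSatakeTransform_le_weylInvariants`.

## References
* [AndrianovZhuravlev1995] A. N. Andrianov, V. G. Zhuravlev, *Modular Forms and Hecke Operators*, Transl. Math. Monogr. 145
  (1995), Ch. 3 §3 Thm. 3.7, §3.3 (3.44)–(3.51), Lemma 3.27, Lemma 3.29, Lemma 3.34, Thm. 3.30.
* [CartierCorvallis1979] P. Cartier, *Representations of 𝔭-adic groups: a survey*, PSPM 33.1 (1979), §IV (4.2), Thm. 4.1 (b).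
* [Satake1963] I. Satake, *Theory of spherical functions on reductive algebraic groups over 𝔭-adic fields*, Publ. Math. IHÉS 18
  (1963), §7 (`Sp_n`, `GSp_n`: Weyl groups of signed permutations), §8.3.
* [ShimuraIATAF1971] G. Shimura, *Introduction to the Arithmetic Theory of Automorphic Functions* (1971), Prop. 3.17.
* [Serre1979] J.-P. Serre, *Local Fields*, GTM 67 (1979), Ch. I §1.
-/

noncomputable section

open scoped Valued WithZero MatrixGroups
open Matrix MonoidAlgebra Representation MulAction

namespace Literature.NumberTheory.Automorphic.SymplecticCartan

open Literature.NumberTheory.Automorphic Literature.NumberTheory.Automorphic.CartanUnique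
  Literature.NumberTheory.Automorphic.HermitianLattice

/-! ## §1 The Weyl group `W(GSp_{2n}) = (ℤ/2)^n ⋊ S_n` acting on `X_*(S) = ℤⁿ × ℤ` -/

section Weyl

variable {n : ℕ}

/-- **The element `(ε, π)` of the Weyl group of `GSp_{2n}` acting on the cocharacter lattice `ℤⁿ × ℤ`**:
`(μ, c) ↦ ((μ_{π i} if ε_i = 1, c - μ_{π i} if ε_i = -1)_i, c)` — the permutations of `x_1, …, x_n` and the involutions
`τ_i : x_0 ↦ x_0 x_i, x_i ↦ x_i⁻¹` of Andrianov–Zhuravlev, read on exponents (`x_0^c x^μ`: `τ_i` sends `μ_i ↦ c - μ_i`).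
[cite: AndrianovZhuravlev1995, Ch. 3 §3.3 (3.51)] [cite: Satake1963, §7] -/
def similitudeSignedPermEquiv (ε : Fin n → ℤˣ) (π : Equiv.Perm (Fin n)) : ((Fin n → ℤ) × ℤ) ≃ₗ[ℤ] ((Fin n → ℤ) × ℤ) where
  toFun μc := (fun i => if ε i = 1 then μc.1 (π i) else μc.2 - μc.1 (π i), μc.2)
  invFun νc := (fun j => if ε (π.symm j) = 1 then νc.1 (π.symm j) else νc.2 - νc.1 (π.symm j), νc.2)
  map_add' x y := by
    refine Prod.ext (funext fun i => ?_) rfl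
    simp only [Prod.fst_add, Prod.snd_add, Pi.add_apply]
    split_ifs <;> ring
  map_smul' r x := by
    refine Prod.ext (funext fun i => ?_) rfl
    simp only [Prod.smul_fst, Prod.smul_snd, Pi.smul_apply, smul_eq_mul, RingHom.id_apply]
    split_ifs <;> ring
  left_inv x := by
    refine Prod.ext (funext fun j => ?_) rfl
    simp only [Equiv.apply_symm_apply]
    split_ifs <;> ring
  right_inv x := by
    refine Prod.ext (funext fun i => ?_) rfl
    simp only [Equiv.symm_apply_apply]
    split_ifs <;> ring

/-- `similitudeSignedPermEquiv ε π (μ, c) = ((ε_i = 1 ? μ_{π i} : c - μ_{π i})_i, c)`. [cite: AndrianovZhuravlev1995, Ch. 3 §3.3 (3.51)] -/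
@[simp] theorem similitudeSignedPermEquiv_apply (ε : Fin n → ℤˣ) (π : Equiv.Perm (Fin n)) (μc : (Fin n → ℤ) × ℤ) :
    similitudeSignedPermEquiv ε π μc = (fun i => if ε i = 1 then μc.1 (π i) else μc.2 - μc.1 (π i), μc.2) := rfl

/-- On multiplier-zero exponents `(μ, 0)` the Weyl group of `GSp_{2n}` acts by the signed permutations of `ℤⁿ` (the Weyl group of
`Sp_{2n}`): `(μ, 0) ↦ ((ε_i μ_{π i})_i, 0)`. [cite: Satake1963, §7] [cite: AndrianovZhuravlev1995, Ch. 3 §3.3 (3.51)] -/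
theorem similitudeSignedPermEquiv_apply_zero (ε : Fin n → ℤˣ) (π : Equiv.Perm (Fin n)) (μ : Fin n → ℤ) :
    similitudeSignedPermEquiv ε π (μ, 0) = (fun i => (ε i : ℤ) * μ (π i), 0) := by
  rw [similitudeSignedPermEquiv_apply]
  refine Prod.ext (funext fun i => ?_) rfl
  dsimp only
  split_ifs with h
  · rw [h, Units.val_one, one_mul]
  · rw [(Int.units_eq_one_or (ε i)).resolve_left h, Units.val_neg, Units.val_one, neg_one_mul, zero_sub]

/-- The central exponents `(k·1, 2k)` (of `ϖ^k · 1`) are fixed by the Weyl group. [cite: AndrianovZhuravlev1995, Ch. 3 §3.3 Lemma 3.27, (3.51)] -/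
theorem similitudeSignedPermEquiv_apply_const (ε : Fin n → ℤˣ) (π : Equiv.Perm (Fin n)) (k : ℤ) :
    similitudeSignedPermEquiv ε π (fun _ => k, 2 * k) = (fun _ => k, 2 * k) := by
  rw [similitudeSignedPermEquiv_apply]
  refine Prod.ext (funext fun i => ?_) rfl
  dsimp only
  split_ifs <;> ring

/-- The multiplier exponent is preserved: `(w λ).2 = λ.2`. [cite: AndrianovZhuravlev1995, Ch. 3 §3.3 (3.51)] -/
@[simp] theorem snd_similitudeSignedPermEquiv (ε : Fin n → ℤˣ) (π : Equiv.Perm (Fin n)) (μc : (Fin n → ℤ) × ℤ) :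
    (similitudeSignedPermEquiv ε π μc).2 = μc.2 := rfl

/-- **The Weyl group `W(GSp_{2n}) ≤ Aut_ℤ(ℤⁿ × ℤ)`**: the subgroup generated by the `(ε, π)` — Andrianov–Zhuravlev's `W_n`
(generated by the permutations of `x_1, …, x_n` and `τ_1, …, τ_n`). [cite: AndrianovZhuravlev1995, Ch. 3 §3.3 (3.51)] [cite: Satake1963, §7] -/
def similitudeWeylGroup (n : ℕ) : Subgroup (((Fin n → ℤ) × ℤ) ≃ₗ[ℤ] ((Fin n → ℤ) × ℤ)) :=
  Subgroup.closure (Set.range fun p : (Fin n → ℤˣ) × Equiv.Perm (Fin n) => similitudeSignedPermEquiv p.1 p.2)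

/-- The generators lie in `W(GSp_{2n})`. [cite: AndrianovZhuravlev1995, Ch. 3 §3.3 (3.51)] -/
theorem similitudeSignedPermEquiv_mem_similitudeWeylGroup (ε : Fin n → ℤˣ) (π : Equiv.Perm (Fin n)) :
    similitudeSignedPermEquiv ε π ∈ similitudeWeylGroup n :=
  Subgroup.subset_closure ⟨(ε, π), rfl⟩

variable {R : Type*} [CommRing R]

/-- **Membership in `R[ℤⁿ × ℤ]^{W(GSp_{2n})}` is invariance of the coefficients under every `(ε, π)`.** [cite: CartierCorvallis1979, §IV.2]
[cite: AndrianovZhuravlev1995, Ch. 3 §3.3 Thm. 3.30] -/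
theorem mem_weylInvariants_similitudeWeylGroup_iff (f : AddMonoidAlgebra R ((Fin n → ℤ) × ℤ)) :
    f ∈ weylInvariants R ((Fin n → ℤ) × ℤ) (similitudeWeylGroup n) ↔
      ∀ (ε : Fin n → ℤˣ) (π : Equiv.Perm (Fin n)) (μc : (Fin n → ℤ) × ℤ),
        f.coeff (similitudeSignedPermEquiv ε π μc) = f.coeff μc := by
  rw [mem_weylInvariants_iff]
  constructor
  · intro h ε π μc
    exact (domCongr_eq_self_iff_coeff _ f).1 (h _ (similitudeSignedPermEquiv_mem_similitudeWeylGroup ε π)) μc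
  · intro h w hw
    unfold similitudeWeylGroup at hw
    induction hw using Subgroup.closure_induction with
    | mem w hw =>
      obtain ⟨⟨ε, π⟩, rfl⟩ := hw
      exact (domCongr_eq_self_iff_coeff _ f).2 (h ε π)
    | one => exact (domCongr_eq_self_iff_coeff _ f).2 fun _ => rfl
    | mul a b _ _ ha hb =>
      rw [domCongr_eq_self_iff_coeff] at ha hb ⊢
      exact fun x => (ha (b x)).trans (hb x)
    | inv a _ ha =>
      rw [domCongr_eq_self_iff_coeff] at ha ⊢
      intro x
      have hx := ha (a.symm x)
      change f.coeff (a (a.symm x)) = f.coeff (a.symm x) at hx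
      rw [LinearEquiv.apply_symm_apply] at hx
      exact hx.symm

/-- **A multiplier-zero element of `R[ℤⁿ × ℤ]` invariant under the signed permutations of `ℤⁿ` is `W(GSp_{2n})`-invariant.**
[cite: Satake1963, §7] [cite: AndrianovZhuravlev1995, Ch. 3 §3.3 Thm. 3.30] -/
theorem coeff_similitudeSignedPermEquiv_eq_of_zero {f : AddMonoidAlgebra R ((Fin n → ℤ) × ℤ)}
    (h0 : ∀ (μ : Fin n → ℤ) (c : ℤ), c ≠ 0 → f.coeff (μ, c) = 0)
    (h : ∀ (ε : Fin n → ℤˣ) (π : Equiv.Perm (Fin n)) (μ : Fin n → ℤ), f.coeff (fun i => (ε i : ℤ) * μ (π i), 0) = f.coeff (μ, 0))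
    (ε : Fin n → ℤˣ) (π : Equiv.Perm (Fin n)) (μc : (Fin n → ℤ) × ℤ) :
    f.coeff (similitudeSignedPermEquiv ε π μc) = f.coeff μc := by
  obtain ⟨μ, c⟩ := μc
  by_cases hc : c = 0
  · subst hc
    rw [similitudeSignedPermEquiv_apply_zero, h]
  · rw [h0 μ c hc, similitudeSignedPermEquiv_apply, h0 _ c hc]

end Weyl

/-! ## §2 A lemma on group algebras over `ℚ`: non-negative coefficients -/

section Algebra

variable {X : Type*} [AddCommGroup X]

/-- **An element of `ℚ[X]` with non-negative coefficients which some relabelling of exponents sends to its negative is `0`.**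
[cite: AndrianovZhuravlev1995, Ch. 3 §3.3 Thm. 3.30] -/
theorem eq_zero_of_domCongr_eq_neg {e : X ≃+ X} {f : AddMonoidAlgebra ℚ X} (hf : ∀ x, 0 ≤ f.coeff x)
    (h : AddMonoidAlgebra.domCongr ℚ ℚ e f = -f) : f = 0 := by
  refine AddMonoidAlgebra.ext (Finsupp.ext fun x => le_antisymm ?_ (hf x))
  have hx := congrArg (fun g : AddMonoidAlgebra ℚ X => g.coeff (e x)) h
  simp only [AddMonoidAlgebra.coeff_domCongr, AddEquiv.symm_apply_apply, AddMonoidAlgebra.coeff_neg, Finsupp.neg_apply] at hx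
  have h1 := hf (e x)
  rw [AddMonoidAlgebra.coeff_zero, Finsupp.zero_apply]
  linarith

end Algebra

/-! ## §3 The square trick over `ℚ`: `𝒮(T_g)² = 𝒮(T_{ϖ^{c(g)}·1}) · 𝒮(T_g T_{g⁻¹})` is `W`-invariant, hence so is `𝒮(T_g)` -/

section Rational

variable {K : Type*} [Field K] [Valued K ℤᵐ⁰] {ϖ : K} {n : ℕ} [NeZero n] [CompactSpace 𝒪[K]] [Finite 𝓀[K]]
  [IsHeckeTriple (⊤ : Submonoid (symplecticSimilitudeGroup (Fin n) K)) (symplecticSimilitudeInt (Fin n) K)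
    (symplecticSimilitudeInt (Fin n) K)]

omit [NeZero n] [CompactSpace 𝒪[K]] [Finite 𝓀[K]]
  [IsHeckeTriple (⊤ : Submonoid (symplecticSimilitudeGroup (Fin n) K)) (symplecticSimilitudeInt (Fin n) K)
    (symplecticSimilitudeInt (Fin n) K)] in
/-- **The transform of the central operator `T_{ϖ^k·1}` is the monomial `q^{⟨ρ, k·1⟩} x^{(k·1, 2k)}`** (a single coset).
[cite: AndrianovZhuravlev1995, Ch. 3 §3.3 Lemma 3.27, Lemma 3.34] [cite: CartierCorvallis1979, §IV (4.2)] -/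
theorem similitudeSatakeTransform_doubleCosetOperator_central [NeZero n] {R : Type*} [CommRing R]
    [IsHeckeTriple (⊤ : Submonoid (symplecticSimilitudeGroup (Fin n) K)) (symplecticSimilitudeInt (Fin n) K)
      (symplecticSimilitudeInt (Fin n) K)]
    (hϖ : Valued.v ϖ = WithZero.exp (-1 : ℤ)) (q : Rˣ) (k : ℤ) :
    similitudeSatakeTransform hϖ q (heckeAlgebra.doubleCosetOperator (symplecticSimilitudeInt (Fin n) K)
        (similitudeTorusElt (uniformizer_ne_zero hϖ) (2 * k) (fun _ : Fin n => -k) : symplecticSimilitudeGroup (Fin n) K)) =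
      AddMonoidAlgebra.single ((fun _ : Fin n => k), 2 * k) ((q ^ symplecticRhoPairing (fun _ : Fin n => k) : Rˣ) : R) := by
  rw [similitudeSatakeTransform_eq, (isIwasawaExponent_similitude hϖ).satakeTransform_doubleCosetOperator_of_central _
    (similitudeTorusElt_two_mul_neg_central (uniformizer_ne_zero hϖ) k), similitudeIwasawaExp_similitudeTorusElt_two_mul_neg,
    similitudeSatakeWeight_ofAdd]

omit [NeZero n] [CompactSpace 𝒪[K]]
  [IsHeckeTriple (⊤ : Submonoid (symplecticSimilitudeGroup (Fin n) K)) (symplecticSimilitudeInt (Fin n) K)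
    (symplecticSimilitudeInt (Fin n) K)] in
/-- The residue field is non-empty and finite: `0 < #𝓀`. [cite: Serre1979, Ch. I §1] -/
theorem natCard_residueField_pos : 0 < Nat.card 𝓀[K] := Nat.card_pos

/-- **THE SQUARE TRICK** (over `ℚ`, `q = #𝓀`): for every `g ∈ GSp(J, K)` and every `(ε, π)`,
`𝒮_q(T_g)_{w_{ε,π} λ} = 𝒮_q(T_g)_λ`.  Proof: with `K₀' g K₀' = K₀' t(m, a) K₀'` one has `T_{g⁻¹} = T_{ϖ^{-m}·1} T_g`, so
`𝒮(T_g)² · 𝒮(T_{ϖ^{-m}·1}) = 𝒮(T_g T_{g⁻¹})`, which is `W`-invariant (multiplier-zero part: the `Sp_{2n}` theorem, via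
`SymplecticSimilitudeSatakeSpTransfer`), as is the unit monomial `𝒮(T_{ϖ^{-m}·1})`; hence `(w𝒮(T_g))² = 𝒮(T_g)²` in the domain
`ℚ[ℤⁿ × ℤ]`, so `w𝒮(T_g) = ±𝒮(T_g)`, and the sign is `+` because all coefficients of `𝒮(T_g)` are `≥ 0`.
[cite: AndrianovZhuravlev1995, Ch. 3 §3.3 Thm. 3.30] [cite: CartierCorvallis1979, §IV Thm. 4.1 (b)] [cite: Satake1963, §7] -/
theorem coeff_similitudeSatakeTransform_doubleCosetOperator_signedPerm_rat (hϖ : Valued.v ϖ = WithZero.exp (-1 : ℤ))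
    (q : ℚˣ) (hq : (q : ℚ) = Nat.card 𝓀[K]) (g : symplecticSimilitudeGroup (Fin n) K)
    (ε : Fin n → ℤˣ) (π : Equiv.Perm (Fin n)) (μc : (Fin n → ℤ) × ℤ) :
    (similitudeSatakeTransform hϖ q (heckeAlgebra.doubleCosetOperator (symplecticSimilitudeInt (Fin n) K) g)).coeff
        (similitudeSignedPermEquiv ε π μc) =
      (similitudeSatakeTransform hϖ q (heckeAlgebra.doubleCosetOperator (symplecticSimilitudeInt (Fin n) K) g)).coeff μc := by
  classical
  have hϖ0 := uniformizer_ne_zero hϖ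
  have hq0 : (0 : ℚ) < (q : ℚ) := by rw [hq]; exact_mod_cast natCard_residueField_pos (K := K)
  -- the Cartan double coset of `g` and the inversion formula `T_{g⁻¹} = T_{ϖ^{-m}·1} T_g`
  obtain ⟨m, a, -, -, hg⟩ := exists_dominant_similitudeTorusElt_mem_orbit hϖ
    (g : symplecticSimilitudeGroup (Fin n) K ⧸ symplecticSimilitudeInt (Fin n) K)
  have hinv := doubleCosetOperator_inv_similitude (R := ℚ) hϖ g hg
  set F := similitudeSatakeTransform hϖ q (heckeAlgebra.doubleCosetOperator (symplecticSimilitudeInt (Fin n) K) g) with hF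
  set G := similitudeSatakeTransform hϖ q (heckeAlgebra.doubleCosetOperator (symplecticSimilitudeInt (Fin n) K) g *
    heckeAlgebra.doubleCosetOperator (symplecticSimilitudeInt (Fin n) K) g⁻¹) with hG
  set ν : (Fin n → ℤ) × ℤ := ((fun _ : Fin n => -m), 2 * (-m)) with hν
  set u : ℚ := ((q ^ symplecticRhoPairing (fun _ : Fin n => -m) : ℚˣ) : ℚ) with hu
  have hu0 : u ≠ 0 := Units.ne_zero _
  have hz : similitudeSatakeTransform hϖ q (heckeAlgebra.doubleCosetOperator (symplecticSimilitudeInt (Fin n) K)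
      (similitudeTorusElt hϖ0 (2 * (-m)) (fun _ : Fin n => -(-m)) : symplecticSimilitudeGroup (Fin n) K)) =
      AddMonoidAlgebra.single ν u := similitudeSatakeTransform_doubleCosetOperator_central hϖ q (-m)
  -- `F² · x^ν u = G`
  have hFG : F * F * AddMonoidAlgebra.single ν u = G := by
    rw [hG, map_mul, hinv, map_mul, hz, ← hF]; ring
  -- `G` is `W`-invariant (multiplier-zero part + the `Sp_{2n}` theorem)
  have hgg' : (similitudeIwasawaExp hϖ g).2 + (similitudeIwasawaExp hϖ g⁻¹).2 = 0 := by
    rw [snd_similitudeIwasawaExp_inv]; ring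
  have hGinv : ∀ x, G.coeff (similitudeSignedPermEquiv ε π x) = G.coeff x :=
    coeff_similitudeSignedPermEquiv_eq_of_zero
      (fun μ c hc => coeff_similitudeSatakeTransform_of_subset_of_ne_zero hϖ q
        (support_toVector_doubleCosetOperator_mul_subset_range hϖ hgg') μ hc)
      (fun ε' π' μ => coeff_similitudeSatakeTransform_mul_signedPerm hϖ q hq hgg' ε' π' μ 0) ε π
  set σ := AddMonoidAlgebra.domCongr ℚ ℚ (similitudeSignedPermEquiv ε π).toAddEquiv with hσ
  have hσG : σ G = G := (domCongr_eq_self_iff_coeff _ G).2 hGinv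
  have hσu : σ (AddMonoidAlgebra.single ν u) = AddMonoidAlgebra.single ν u := by
    rw [hσ, AddMonoidAlgebra.domCongr_single]
    exact congrArg (AddMonoidAlgebra.single · u) (similitudeSignedPermEquiv_apply_const ε π (-m))
  -- `(σF)² = F²` in the domain `ℚ[ℤⁿ × ℤ]`
  have hsq : σ F * σ F = F * F := by
    have h1 : σ F * σ F * AddMonoidAlgebra.single ν u = F * F * AddMonoidAlgebra.single ν u := by
      conv_lhs => rw [← hσu, ← map_mul, ← map_mul, hFG, hσG, ← hFG]
    exact mul_right_cancel₀ (AddMonoidAlgebra.single_ne_zero.2 hu0) h1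
  -- non-negativity of the coefficients of `F`
  have hpos : ∀ x, 0 ≤ F.coeff x := fun x => by
    rw [hF, coeff_similitudeSatakeTransform_doubleCosetOperator, Units.val_zpow_eq_zpow_val]
    exact mul_nonneg (Nat.cast_nonneg _) (zpow_pos hq0 _).le
  have hfix : σ F = F := by
    rcases mul_self_eq_mul_self_iff.1 hsq with h | h
    · exact h
    · rw [eq_zero_of_domCongr_eq_neg hpos h, map_zero]
  exact (domCongr_eq_self_iff_coeff _ F).1 hfix μc

end Rational

/-! ## §4 The counting identity in `ℕ` and the invariance over every coefficient ring -/

section Counting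

variable {K : Type*} [Field K] [Valued K ℤᵐ⁰] {ϖ : K} {n : ℕ} [NeZero n] [CompactSpace 𝒪[K]] [Finite 𝓀[K]]
  [IsHeckeTriple (⊤ : Submonoid (symplecticSimilitudeGroup (Fin n) K)) (symplecticSimilitudeInt (Fin n) K)
    (symplecticSimilitudeInt (Fin n) K)]

/-- **THE COUNTING IDENTITY** behind the Weyl-group invariance: for `N(λ) = #{γ ∈ K₀'gK₀'/K₀' : (a,c)(γ) = λ}`, `q = #𝓀`,
`E = ⟨ρ, (wλ)₁⟩ - ⟨ρ, λ₁⟩`:  **`N(wλ) · q^{E⁺} = N(λ) · q^{(-E)⁺}`** (an identity of natural numbers; the `w₀` case is the tree's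
`card_filter_similitudeIwasawaExp_mul_pow_eq`). [cite: AndrianovZhuravlev1995, Ch. 3 §3.3 (3.44), Thm. 3.30] [cite: CartierCorvallis1979, §IV Thm. 4.1 (b)] -/
theorem card_filter_similitudeIwasawaExp_signedPerm_mul_pow_eq (hϖ : Valued.v ϖ = WithZero.exp (-1 : ℤ))
    (g : symplecticSimilitudeGroup (Fin n) K) (ε : Fin n → ℤˣ) (π : Equiv.Perm (Fin n)) (μc : (Fin n → ℤ) × ℤ)
    [DecidablePred fun γ : symplecticSimilitudeGroup (Fin n) K ⧸ symplecticSimilitudeInt (Fin n) K =>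
      similitudeIwasawaExp hϖ γ.out = similitudeSignedPermEquiv ε π μc]
    [DecidablePred fun γ : symplecticSimilitudeGroup (Fin n) K ⧸ symplecticSimilitudeInt (Fin n) K =>
      similitudeIwasawaExp hϖ γ.out = μc] :
    ((finite_orbit_quotient (symplecticSimilitudeInt (Fin n) K) g).toFinset.filter
        fun γ => similitudeIwasawaExp hϖ γ.out = similitudeSignedPermEquiv ε π μc).card *
        Nat.card 𝓀[K] ^ (symplecticRhoPairing (similitudeSignedPermEquiv ε π μc).1 - symplecticRhoPairing μc.1).toNat =
      ((finite_orbit_quotient (symplecticSimilitudeInt (Fin n) K) g).toFinset.filter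
        fun γ => similitudeIwasawaExp hϖ γ.out = μc).card *
        Nat.card 𝓀[K] ^ (symplecticRhoPairing μc.1 - symplecticRhoPairing (similitudeSignedPermEquiv ε π μc).1).toNat := by
  classical
  have hqN : (Nat.card 𝓀[K] : ℚ) ≠ 0 := by exact_mod_cast (natCard_residueField_pos (K := K)).ne'
  set q : ℚˣ := Units.mk0 (Nat.card 𝓀[K] : ℚ) hqN with hqdef
  have hq : (q : ℚ) = Nat.card 𝓀[K] := rfl
  have H := coeff_similitudeSatakeTransform_doubleCosetOperator_signedPerm_rat hϖ q hq g ε π μc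
  rw [coeff_similitudeSatakeTransform_doubleCosetOperator, coeff_similitudeSatakeTransform_doubleCosetOperator,
    Units.val_zpow_eq_zpow_val, Units.val_zpow_eq_zpow_val] at H
  set e₁ := symplecticRhoPairing (similitudeSignedPermEquiv ε π μc).1 with he₁
  set e₂ := symplecticRhoPairing μc.1 with he₂
  have hd : ((e₁ - e₂).toNat : ℤ) - e₁ = ((e₂ - e₁).toNat : ℤ) - e₂ := by omega
  refine Nat.cast_injective (R := ℚ) ?_
  push_cast
  rw [← hq]
  calc (_ : ℚ) * (q : ℚ) ^ (e₁ - e₂).toNat = _ * (q : ℚ) ^ e₁ * (q : ℚ) ^ (((e₁ - e₂).toNat : ℤ) - e₁) := by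
        rw [mul_assoc, ← zpow_natCast, ← zpow_add₀ q.ne_zero]; congr 2; ring
    _ = _ * (q : ℚ) ^ e₂ * (q : ℚ) ^ (((e₂ - e₁).toNat : ℤ) - e₂) := by
        rw [Finset.filter_congr_decidable, Finset.filter_congr_decidable] at H
        rw [H, hd]
    _ = _ * (q : ℚ) ^ (e₂ - e₁).toNat := by
        rw [mul_assoc, ← zpow_natCast, ← zpow_add₀ q.ne_zero]; congr 2; ring

variable {R : Type*} [CommRing R]

/-- **`𝒮_q(T_g)_{wλ} = 𝒮_q(T_g)_λ` over EVERY commutative ring `R` in which the residue cardinality is a unit `q`**, for every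
`g ∈ GSp_{2n}(K)` and every `w = (ε, π) ∈ W(GSp_{2n})`: the coefficient formula `𝒮_q(T_g)_λ = N(λ) q^{⟨ρ, λ₁⟩}` and the counting
identity. [cite: AndrianovZhuravlev1995, Ch. 3 §3.3 (3.44), Thm. 3.30] [cite: CartierCorvallis1979, §IV (4.2), Thm. 4.1 (b)] -/
theorem coeff_similitudeSatakeTransform_doubleCosetOperator_signedPerm (hϖ : Valued.v ϖ = WithZero.exp (-1 : ℤ)) (q : Rˣ)
    (hq : (q : R) = Nat.card 𝓀[K]) (g : symplecticSimilitudeGroup (Fin n) K)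
    (ε : Fin n → ℤˣ) (π : Equiv.Perm (Fin n)) (μc : (Fin n → ℤ) × ℤ) :
    (similitudeSatakeTransform hϖ q (heckeAlgebra.doubleCosetOperator (symplecticSimilitudeInt (Fin n) K) g)).coeff
        (similitudeSignedPermEquiv ε π μc) =
      (similitudeSatakeTransform hϖ q (heckeAlgebra.doubleCosetOperator (symplecticSimilitudeInt (Fin n) K) g)).coeff μc := by
  classical
  have hC := card_filter_similitudeIwasawaExp_signedPerm_mul_pow_eq hϖ g ε π μc
  set E := symplecticRhoPairing (similitudeSignedPermEquiv ε π μc).1 - symplecticRhoPairing μc.1 with hE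
  have hE' : symplecticRhoPairing μc.1 - symplecticRhoPairing (similitudeSignedPermEquiv ε π μc).1 = -E := by rw [hE]; ring
  rw [hE'] at hC
  have hC' : (((finite_orbit_quotient (symplecticSimilitudeInt (Fin n) K) g).toFinset.filter
        fun γ => similitudeIwasawaExp hϖ γ.out = similitudeSignedPermEquiv ε π μc).card : R) * ((q ^ (E.toNat : ℤ) : Rˣ) : R) =
      (((finite_orbit_quotient (symplecticSimilitudeInt (Fin n) K) g).toFinset.filter
        fun γ => similitudeIwasawaExp hϖ γ.out = μc).card : R) * ((q ^ ((-E).toNat : ℤ) : Rˣ) : R) := by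
    have h := congrArg (Nat.cast : ℕ → R) hC
    push_cast at h
    rwa [← hq, ← Units.val_pow_eq_pow_val, ← Units.val_pow_eq_pow_val, ← zpow_natCast, ← zpow_natCast] at h
  rw [coeff_similitudeSatakeTransform_doubleCosetOperator, coeff_similitudeSatakeTransform_doubleCosetOperator]
  have e1 : q ^ symplecticRhoPairing (similitudeSignedPermEquiv ε π μc).1 =
      q ^ (E.toNat : ℤ) * q ^ (symplecticRhoPairing μc.1 + E - (E.toNat : ℤ)) := by
    rw [← _root_.zpow_add]; congr 1; rw [hE]; ring
  have e2 : q ^ symplecticRhoPairing μc.1 = q ^ ((-E).toNat : ℤ) * q ^ (symplecticRhoPairing μc.1 + E - (E.toNat : ℤ)) := by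
    rw [← _root_.zpow_add]; congr 1; omega
  rw [e1, e2, Units.val_mul, Units.val_mul, ← mul_assoc, ← mul_assoc, hC']

/-- **THE WEYL-GROUP INVARIANCE OF THE SATAKE TRANSFORM OF `GSp_{2n}`, EVERY RANK, EVERY COMMUTATIVE COEFFICIENT RING** in which
the residue cardinality is a unit `q`: for every `T ∈ ℋ_R(GSp_{2n}(K), GSp_{2n}(𝒪))`, every `(ε, π) ∈ W(GSp_{2n}) = (ℤ/2)^n ⋊ S_n`
and every `(μ, c) ∈ ℤⁿ × ℤ`, **`𝒮_q(T)_{((μ_{π i} | c - μ_{π i})_i, c)} = 𝒮_q(T)_{(μ, c)}`** — Andrianov–Zhuravlev's «the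
`Ω`-image is `W_n`-invariant» (Thm. 3.30) / Cartier's Thm. 4.1 (b) for `G = GSp_{2n}`. [cite: AndrianovZhuravlev1995, Ch. 3 §3.3 Thm. 3.30]
[cite: CartierCorvallis1979, §IV Thm. 4.1 (b)] [cite: Satake1963, §7] -/
theorem coeff_similitudeSatakeTransform_signedPerm (hϖ : Valued.v ϖ = WithZero.exp (-1 : ℤ)) (q : Rˣ)
    (hq : (q : R) = Nat.card 𝓀[K])
    (T : heckeAlgebra R (symplecticSimilitudeGroup (Fin n) K) (symplecticSimilitudeInt (Fin n) K))
    (ε : Fin n → ℤˣ) (π : Equiv.Perm (Fin n)) (μc : (Fin n → ℤ) × ℤ) :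
    (similitudeSatakeTransform hϖ q T).coeff (similitudeSignedPermEquiv ε π μc) = (similitudeSatakeTransform hϖ q T).coeff μc := by
  have hT := heckeAlgebra.mem_span_range_doubleCosetOperator (symplecticSimilitudeInt (Fin n) K) T
  induction hT using Submodule.span_induction with
  | mem S hS =>
    obtain ⟨g, rfl⟩ := hS
    exact coeff_similitudeSatakeTransform_doubleCosetOperator_signedPerm hϖ q hq g ε π μc
  | zero => simp
  | add S S' _ _ hS hS' =>
    rw [map_add, AddMonoidAlgebra.coeff_add, Finsupp.add_apply, Finsupp.add_apply, hS, hS']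
  | smul r S _ hS =>
    rw [map_smul, AddMonoidAlgebra.coeff_smul, Finsupp.smul_apply, Finsupp.smul_apply, hS]

/-- The same with the Weyl element spelled out: `𝒮_q(T)_{((ε_i = 1 ? μ_{π i} : c - μ_{π i})_i, c)} = 𝒮_q(T)_{(μ, c)}`.
[cite: AndrianovZhuravlev1995, Ch. 3 §3.3 Thm. 3.30] -/
theorem coeff_similitudeSatakeTransform_signedPerm' (hϖ : Valued.v ϖ = WithZero.exp (-1 : ℤ)) (q : Rˣ)
    (hq : (q : R) = Nat.card 𝓀[K])
    (T : heckeAlgebra R (symplecticSimilitudeGroup (Fin n) K) (symplecticSimilitudeInt (Fin n) K))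
    (ε : Fin n → ℤˣ) (π : Equiv.Perm (Fin n)) (μ : Fin n → ℤ) (c : ℤ) :
    (similitudeSatakeTransform hϖ q T).coeff (fun i => if ε i = 1 then μ (π i) else c - μ (π i), c) =
      (similitudeSatakeTransform hϖ q T).coeff (μ, c) :=
  coeff_similitudeSatakeTransform_signedPerm hϖ q hq T ε π (μ, c)

/-- **`S_n`-invariance**: `𝒮_q(T)_{(μ ∘ π, c)} = 𝒮_q(T)_{(μ, c)}` («symmetric in `x_1, …, x_n`», A–Z Lemma 3.29 / (3.49)).
[cite: AndrianovZhuravlev1995, Ch. 3 §3.3 Lemma 3.29, Thm. 3.30] [cite: CartierCorvallis1979, §IV Thm. 4.1 (b)] -/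
theorem coeff_similitudeSatakeTransform_comp_perm (hϖ : Valued.v ϖ = WithZero.exp (-1 : ℤ)) (q : Rˣ)
    (hq : (q : R) = Nat.card 𝓀[K])
    (T : heckeAlgebra R (symplecticSimilitudeGroup (Fin n) K) (symplecticSimilitudeInt (Fin n) K))
    (π : Equiv.Perm (Fin n)) (μ : Fin n → ℤ) (c : ℤ) :
    (similitudeSatakeTransform hϖ q T).coeff (μ ∘ π, c) = (similitudeSatakeTransform hϖ q T).coeff (μ, c) := by
  have h := coeff_similitudeSatakeTransform_signedPerm' hϖ q hq T (fun _ => 1) π μ c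
  simp only [if_true] at h
  exact h

/-- **`τ_j`-invariance**: `𝒮_q(T)_{(μ with μ_j ↦ c - μ_j, c)} = 𝒮_q(T)_{(μ, c)}` (A–Z's `τ_j : x_0 ↦ x_0 x_j, x_j ↦ x_j⁻¹`).
[cite: AndrianovZhuravlev1995, Ch. 3 §3.3 (3.51), Thm. 3.30] -/
theorem coeff_similitudeSatakeTransform_tau (hϖ : Valued.v ϖ = WithZero.exp (-1 : ℤ)) (q : Rˣ)
    (hq : (q : R) = Nat.card 𝓀[K])
    (T : heckeAlgebra R (symplecticSimilitudeGroup (Fin n) K) (symplecticSimilitudeInt (Fin n) K))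
    (j : Fin n) (μ : Fin n → ℤ) (c : ℤ) :
    (similitudeSatakeTransform hϖ q T).coeff (Function.update μ j (c - μ j), c) = (similitudeSatakeTransform hϖ q T).coeff (μ, c) := by
  have h := coeff_similitudeSatakeTransform_signedPerm' hϖ q hq T (Function.update (fun _ => 1) j (-1)) 1 μ c
  have hfun : (fun i => if Function.update (fun _ : Fin n => (1 : ℤˣ)) j (-1) i = 1 then μ ((1 : Equiv.Perm (Fin n)) i)
      else c - μ ((1 : Equiv.Perm (Fin n)) i)) = Function.update μ j (c - μ j) := by
    funext i
    by_cases hij : i = j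
    · subst hij
      rw [Function.update_self, Function.update_self, if_neg (by decide), Equiv.Perm.coe_one, id]
    · rw [Function.update_of_ne hij, Function.update_of_ne hij, if_pos rfl, Equiv.Perm.coe_one, id]
  rw [hfun] at h
  exact h

/-- **`𝒮_q(T) ∈ R[ℤⁿ × ℤ]^{W(GSp_{2n})}`** for every `T ∈ ℋ_R(GSp_{2n}(K), GSp_{2n}(𝒪))` (`(q : R) = #𝓀` a unit).
[cite: AndrianovZhuravlev1995, Ch. 3 §3.3 Thm. 3.30] [cite: CartierCorvallis1979, §IV Thm. 4.1 (b)] -/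
theorem similitudeSatakeTransform_mem_weylInvariants (hϖ : Valued.v ϖ = WithZero.exp (-1 : ℤ)) (q : Rˣ)
    (hq : (q : R) = Nat.card 𝓀[K])
    (T : heckeAlgebra R (symplecticSimilitudeGroup (Fin n) K) (symplecticSimilitudeInt (Fin n) K)) :
    similitudeSatakeTransform hϖ q T ∈ weylInvariants R ((Fin n → ℤ) × ℤ) (similitudeWeylGroup n) :=
  (mem_weylInvariants_similitudeWeylGroup_iff _).2 fun ε π μc => coeff_similitudeSatakeTransform_signedPerm hϖ q hq T ε π μc

/-- **The image of the Satake transform of `GSp_{2n}` lies in the Weyl-group invariants**: `𝒮_q(ℋ_R) ≤ R[ℤⁿ × ℤ]^{W(GSp_{2n})}`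
(the inclusion half of A–Z Thm. 3.30 (3) / Cartier Thm. 4.1 (b), every rank, every `R` with `q ∈ Rˣ`).
[cite: AndrianovZhuravlev1995, Ch. 3 §3.3 Thm. 3.30] [cite: CartierCorvallis1979, §IV Thm. 4.1 (b)] -/
theorem range_similitudeSatakeTransform_le_weylInvariants (hϖ : Valued.v ϖ = WithZero.exp (-1 : ℤ)) (q : Rˣ)
    (hq : (q : R) = Nat.card 𝓀[K]) :
    (similitudeSatakeTransform (n := n) (K := K) hϖ q).range ≤ weylInvariants R ((Fin n → ℤ) × ℤ) (similitudeWeylGroup n) := by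
  rintro _ ⟨T, rfl⟩
  exact similitudeSatakeTransform_mem_weylInvariants hϖ q hq T

end Counting

end Literature.NumberTheory.Automorphic.SymplecticCartan

end
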